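import Literature.AlgebraicGeometry.Resolution.ResolutionLocalization
import Literature.AlgebraicGeometry.Resolution.BlowupsFlatBaseChange
import Literature.AlgebraicGeometry.Resolution.GenericFormMissesFibreComponents
import Summits.ResolutionOfSingularities.ResolutionOfSingularities.Theorems.UniversalCellsProductDescentPthPowerSliceAlgebra
import HarnessLib

/-!
# `ProductDescent` (crux stmt-ResolutionOfSingularities-15231), line `birth` — stub `stub_sliceRegular`

Helper file (`--supports stmt-ResolutionOfSingularities-15231`; does not close the item).

THE SLICED SCHEME IS REGULAR NEAR THE FIBRE. Let `π : X₁ → V₁ ⊆ 𝔸ˢ_Y` be proper with `X₁`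
regular, `h := π ≫ V₁.ι ≫ 𝔸ˢ(f) : X₁ → 𝔸ˢ_{𝔽_p}`, `σ := (gᵢᵖ)ᵢ : V → 𝔸ˢ_Y` the `p`-th power
section of `𝔸ˢ_Y → Y` over an open `V ∋ y` and `b := σ(y) ∈ V₁`. If `h` is smooth at every point
of `X₁` over `b`, then over the open `O := V₁ ∖ π(non-smooth locus of h) ∋ b` of `𝔸ˢ_Y` (`π` is a
closed map) every local ring of the sliced scheme `X_σ := X₁ ×_{𝔸ˢ_Y} V` is regular:

* `sliceRegular_stalk_equiv` (local rings of a slice along a section, any `q : X₁ → 𝔸ⁿ_Y`): at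
  `z ∈ X_σ` over `x ∈ X₁` and `y₁ ∈ V`, `𝒪_{X_σ,z} ≅ 𝒪_{X₁,x}/(tᵢ - aᵢ)ᵢ`, `tᵢ` the germ of `q*(Tᵢ)`,
  `aᵢ` the coordinates of `σ` read through `Γ(V, 𝒪_Y) → 𝒪_{Y,y₁} → 𝒪_{X₁,x}`. The chart
  `Spec 𝒪_{X₁,x} ×_{𝔸ⁿ_Y} Spec 𝒪_{Y,y₁} → X_σ` is a flat preimmersion (`flat_fromSpecStalk`), so an
  isomorphism on local rings (`isIso_stalkMap_of_flat_of_isPreimmersion`), with `z` in its image;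
  both factors map through the monomorphism `𝔸ⁿ_{Spec 𝒪_{Y,y₁}} = Spec 𝒪_{Y,y₁}[T] → 𝔸ⁿ_Y`, so the
  source is `Spec (𝒪_{X₁,x} ⊗_{𝒪_{Y,y₁}[T]} 𝒪_{Y,y₁}) = Spec 𝒪_{X₁,x}/(tᵢ - aᵢ)`
  (`sliceRegular_isPullback_affineModel`), a local scheme whose closed point is the point over `z`.
* `sliceRegular_formallySmooth_polynomial`: `𝒪_{X₁,x}` is formally smooth over `𝔽_p[T]` when `h`
  is smooth at `x` (`𝔽_p[T] → 𝒪_{𝔸ˢ_{𝔽_p},h(x)}` is a localization); the ideal `(tᵢ - gᵢᵖ)` is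
  proper, so the `p`-th power slicing lemma `stub_pthPowerSliceAlgebra` (`d(gᵖ) = 0`; landed
  separately) shows that `𝒪_{X₁,x}/(tᵢ - gᵢᵖ)` is regular.

Source: A. Grothendieck, *EGA* IV₄ (Publ. Math. IHÉS 32, 1967), 17.11.1; H. Matsumura,
*Commutative Ring Theory* (1986), Thm. 14.2. The slice lemmas are folklore. [EGAIV4]
-/

set_option linter.dupNamespace false -- mandated namespace of this single-conjunct summit

noncomputable section

open CategoryTheory CategoryTheory.Limits AlgebraicGeometry Literature.AlgebraicGeometry.Resolution
open TensorProduct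

namespace Summit.ResolutionOfSingularities.ResolutionOfSingularities.Theorems.ProductDescent.Birth

universe u

/-- If `P` is the pullback of `f, g`, it is also the pullback of `f ≫ i, g ≫ i` for a
monomorphism `i` (Mathlib's `PullbackCone.isLimitOfCompMono` as an `IsPullback`). [folklore] -/
theorem sliceRegular_isPullback_comp_mono {C : Type*} [Category C] {P X Y W Z : C}
    {fst : P ⟶ X} {snd : P ⟶ Y} {f : X ⟶ W} {g : Y ⟶ W} (h : IsPullback fst snd f g)
    (i : W ⟶ Z) [Mono i] : IsPullback fst snd (f ≫ i) (g ≫ i) :=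
  IsPullback.of_isLimit' ⟨by rw [reassoc_of% h.w]⟩
    (PullbackCone.isLimitOfCompMono f g i _ h.isLimit)

/-- The kernel of the evaluation `R[T₁,…,T_n] → R` at `a` is generated by the `Tᵢ - aᵢ`.
[folklore] -/
theorem sliceRegular_ker_eval {R : Type*} [CommRing R] {n : Type*} (a : n → R) :
    RingHom.ker (MvPolynomial.eval a) = Ideal.span (Set.range fun i =>
      (MvPolynomial.X i - MvPolynomial.C (a i) : MvPolynomial n R)) :=
  le_antisymm (ker_eval_le_of_forall_X_sub_C_mem a fun i => Ideal.subset_span ⟨i, rfl⟩)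
    (Ideal.span_le.mpr (Set.range_subset_iff.mpr fun i => by simp [RingHom.mem_ker]))

/-- If `φ : S → T` is surjective with `S` local and `𝔓 ⊆ T` is a prime contracting to `𝔪_S`,
then `T` is local with maximal ideal `𝔓`. [folklore] -/
theorem sliceRegular_eq_maximalIdeal {S T : Type*} [CommRing S] [CommRing T] [IsLocalRing S]
    (φ : S →+* T) (hsurj : Function.Surjective φ) (𝔓 : Ideal T) [𝔓.IsPrime]
    (h𝔓 : 𝔓.comap φ = IsLocalRing.maximalIdeal S) :
    ∃ _ : IsLocalRing T, 𝔓 = IsLocalRing.maximalIdeal T := by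
  haveI : Nontrivial T := ⟨⟨0, 1, fun h01 => Ideal.IsPrime.ne_top ‹_›
    (Ideal.eq_top_of_isUnit_mem _ 𝔓.zero_mem (by rw [h01]; exact isUnit_one))⟩⟩
  haveI : IsLocalRing T := IsLocalRing.of_surjective' φ hsurj
  refine ⟨inferInstance, le_antisymm (IsLocalRing.le_maximalIdeal (Ideal.IsPrime.ne_top ‹_›)) ?_⟩
  intro u hu
  obtain ⟨s₀, rfl⟩ := hsurj u
  have hs₀ : s₀ ∈ IsLocalRing.maximalIdeal S := by
    rw [IsLocalRing.mem_maximalIdeal, mem_nonunits_iff] at hu ⊢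
    exact fun hunit => hu (hunit.map _)
  exact (h𝔓.symm ▸ hs₀ : s₀ ∈ 𝔓.comap φ)

/-! ## The affine model over a local base: `Spec S ×_{𝔸ⁿ_Y} Spec R = Spec (S ⊗_{R[T]} R)` -/

/-- Let `j : Spec R → Y` be a monomorphism, `ℓ : Spec S → 𝔸ⁿ_Y` a morphism over `Spec R → Y`
(through a ring map `R → S`) and `r : Spec R → 𝔸ⁿ_Y` a section over `j`. For `R[T]`-algebra
structures on `S` and `R` matching the coordinates of `ℓ` and `r`, the square with vertex
`Spec (S ⊗_{R[T]} R)` over `ℓ, r` is cartesian: both maps factor through the monomorphism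
`Spec R[T] = 𝔸ⁿ_{Spec R} → 𝔸ⁿ_Y`, over which the square is `Spec` of a pushout. [folklore] -/
theorem sliceRegular_isPullback_affineModel {n : Type u} {R S : CommRingCat.{u}} {Y : Scheme.{u}}
    (j : Spec R ⟶ Y) [Mono j] (ℓ : Spec S ⟶ 𝔸(n; Y)) (r : Spec R ⟶ 𝔸(n; Y))
    [Algebra (MvPolynomial n R) S] [Algebra (MvPolynomial n R) R]
    (hℓ : ℓ ≫ (𝔸(n; Y) ↘ Y) =
      Spec.map (CommRingCat.ofHom ((algebraMap (MvPolynomial n R) S).comp MvPolynomial.C)) ≫ j)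
    (hr : r ≫ (𝔸(n; Y) ↘ Y) = j)
    (hrC : (algebraMap (MvPolynomial n R) R).comp MvPolynomial.C = RingHom.id R)
    (hℓX : ∀ i, algebraMap (MvPolynomial n R) S (MvPolynomial.X i) =
      (Scheme.ΓSpecIso S).hom (ℓ.appTop (AffineSpace.coord Y i)))
    (hrX : ∀ i, algebraMap (MvPolynomial n R) R (MvPolynomial.X i) =
      (Scheme.ΓSpecIso R).hom (r.appTop (AffineSpace.coord Y i))) :
    IsPullback
      (Spec.map (CommRingCat.ofHom
        (Algebra.TensorProduct.includeLeftRingHom : S →+* S ⊗[MvPolynomial n R] R)))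
      (Spec.map (CommRingCat.ofHom ((Algebra.TensorProduct.includeRight :
          R →ₐ[MvPolynomial n R] S ⊗[MvPolynomial n R] R).toRingHom)))
      ℓ r := by
  -- the monomorphism `N : Spec R[T] = 𝔸ⁿ_{Spec R} → 𝔸ⁿ_Y`
  haveI : Mono (AffineSpace.map n j) :=
    (MorphismProperty.monomorphisms.iff _).mp
      (MorphismProperty.of_isPullback (P := MorphismProperty.monomorphisms Scheme.{u})
        (AffineSpace.isPullback_map (n := n) j).flip
        ((MorphismProperty.monomorphisms.iff _).mpr ‹Mono j›))
  obtain ⟨N, hN⟩ : ∃ N : Spec (CommRingCat.of (MvPolynomial n R)) ⟶ 𝔸(n; Y),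
      N = (AffineSpace.SpecIso n R).inv ≫ AffineSpace.map n j := ⟨_, rfl⟩
  haveI : Mono N := by rw [hN]; exact mono_comp _ _
  -- the coordinates of `Spec T → Spec R[T] → 𝔸ⁿ_Y`
  have hNX {T : CommRingCat.{u}} (φ : CommRingCat.of (MvPolynomial n R) ⟶ T) (i : n) :
      (Spec.map φ ≫ N).appTop (AffineSpace.coord Y i) =
        (Scheme.ΓSpecIso T).inv (φ (MvPolynomial.X i)) := by
    rw [hN]
    simp only [Scheme.Hom.comp_appTop, CommRingCat.comp_apply, AffineSpace.map_appTop_coord,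
      AffineSpace.SpecIso_inv_appTop_coord]
    rw [← CommRingCat.comp_apply, ← Scheme.ΓSpecIso_inv_naturality, CommRingCat.comp_apply]
  have E2 : Spec.map (CommRingCat.ofHom (algebraMap (MvPolynomial n R) S)) ≫ N = ℓ := by
    apply AffineSpace.hom_ext
    · rw [hℓ, hN]
      simp only [Category.assoc, AffineSpace.map_over, AffineSpace.SpecIso_inv_over_assoc]
      rw [← Spec.map_comp_assoc]
      rfl
    · intro i
      rw [hNX]
      change (Scheme.ΓSpecIso S).inv (algebraMap (MvPolynomial n R) S (MvPolynomial.X i)) = _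
      rw [hℓX, Iso.hom_inv_id_apply]
  have E3 : Spec.map (CommRingCat.ofHom (algebraMap (MvPolynomial n R) R)) ≫ N = r := by
    apply AffineSpace.hom_ext
    · rw [hr, hN]
      simp only [Category.assoc, AffineSpace.map_over, AffineSpace.SpecIso_inv_over_assoc]
      rw [← Spec.map_comp_assoc]
      have : CommRingCat.ofHom MvPolynomial.C ≫
          CommRingCat.ofHom (algebraMap (MvPolynomial n R) R) = 𝟙 (CommRingCat.of R) := by
        apply CommRingCat.hom_ext
        rw [CommRingCat.hom_comp, CommRingCat.hom_ofHom, CommRingCat.hom_ofHom]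
        exact hrC
      rw [this, Spec.map_id]
      exact Category.id_comp j
    · intro i
      rw [hNX]
      change (Scheme.ΓSpecIso R).inv (algebraMap (MvPolynomial n R) R (MvPolynomial.X i)) = _
      rw [hrX, Iso.hom_inv_id_apply]
  rw [← E2, ← E3]
  exact sliceRegular_isPullback_comp_mono (isPullback_SpecMap_of_isPushout _ _ _ _
    (CommRingCat.isPushout_tensorProduct (MvPolynomial n R) S R)) N

/-! ## The local rings of the slice `X₁ ×_{𝔸ⁿ_Y} V` along a section -/

/-- **The local rings of a slice.** Let `q : X₁ → 𝔸ⁿ_Y`, `V ⊆ Y` open and `σ : V → 𝔸ⁿ_Y` a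
section of `𝔸ⁿ_Y → Y` over `V` with coordinates `aᵢ ∈ Γ(V, 𝒪_Y)`. At a point `z` of the slice
`X₁ ×_{𝔸ⁿ_Y} V` over `x ∈ X₁`, the local ring is `𝒪_{X₁,x}/(tᵢ - aᵢ)ᵢ`, `tᵢ` the germ of
`q*(Tᵢ)` and `aᵢ` read in `𝒪_{X₁,x}` through `Γ(V, 𝒪_Y) → 𝒪_{Y,y₁} → 𝒪_{X₁,x}`, `y₁` the image of
`x` (chart through the local schemes at `x` and `y₁`, see the module docstring). [folklore] -/
theorem sliceRegular_stalk_equiv {n : Type u} {Y X₁ : Scheme.{u}} (q : X₁ ⟶ 𝔸(n; Y))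
    (V : Y.Opens) (σ : (V : Scheme.{u}) ⟶ 𝔸(n; Y)) (a : n → Γ(V, ⊤))
    (hσ : σ ≫ (𝔸(n; Y) ↘ Y) = V.ι) (hσa : ∀ i, σ.appTop (AffineSpace.coord Y i) = a i)
    (z : ↥(pullback q σ)) :
    ∃ β : Γ(V, ⊤) →+* X₁.presheaf.stalk ((pullback.fst q σ).base z),
      Nonempty ((pullback q σ).presheaf.stalk z ≃+*
        X₁.presheaf.stalk ((pullback.fst q σ).base z) ⧸ Ideal.span (Set.range fun i =>
          X₁.presheaf.germ ⊤ ((pullback.fst q σ).base z) trivial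
            (q.appTop (AffineSpace.coord Y i)) - β (a i))) := by
  -- the points: `x ∈ X₁` under `z`, `y₁ = qY x ∈ V ⊆ Y`
  generalize hx : (pullback.fst q σ).base z = x
  obtain ⟨qY, hqY⟩ : ∃ qY : X₁ ⟶ Y, qY = q ≫ (𝔸(n; Y) ↘ Y) := ⟨_, rfl⟩
  have hpt : qY.base x = V.ι.base ((pullback.snd q σ).base z) := by
    rw [← hx, hqY, ← Scheme.Hom.comp_apply, pullback.condition_assoc, hσ, Scheme.Hom.comp_apply]
  have hy₁ : qY.base x ∈ V := by rw [hpt]; exact ((pullback.snd q σ).base z).2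
  -- the local schemes at `x` and `y₁` and their (flat, preimmersive) maps to `X₁` and `V`
  haveI : Flat (X₁.fromSpecStalk x) := flat_fromSpecStalk X₁ x
  obtain ⟨iV, hiV⟩ : ∃ iV : Spec (Y.presheaf.stalk (qY.base x)) ⟶ (V : Scheme.{u}),
      iV = V.fromSpecStalkOfMem (qY.base x) hy₁ := ⟨_, rfl⟩
  obtain ⟨_, _⟩ : Flat iV ∧ IsPreimmersion iV := by
    haveI := flat_fromSpecStalk (V : Scheme.{u}) ⟨qY.base x, hy₁⟩
    rw [hiV]
    change Flat (Spec.map _ ≫ _) ∧ IsPreimmersion (Spec.map _ ≫ _)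
    exact ⟨inferInstance, inferInstance⟩
  have E1 : Spec.map (qY.stalkMap x) ≫ iV ≫ V.ι = X₁.fromSpecStalk x ≫ qY := by
    rw [hiV, Scheme.Opens.fromSpecStalkOfMem_ι, Scheme.SpecMap_stalkMap_fromSpecStalk]
  have hzx : (pullback.fst q σ).base z ∈ Set.range (X₁.fromSpecStalk x).base := by
    rw [Scheme.range_fromSpecStalk, hx]; exact specializes_rfl
  have hzv : (pullback.snd q σ).base z ∈ Set.range iV.base := by
    rw [hiV]
    change _ ∈ Set.range (Spec.map _ ≫ (V : Scheme.{u}).fromSpecStalk ⟨qY.base x, hy₁⟩).base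
    rw [Scheme.Hom.comp_base, TopCat.coe_comp, Set.range_comp,
      (Spec.map _).surjective.range_eq, Set.image_univ, Scheme.range_fromSpecStalk]
    change (pullback.snd q σ).base z ⤳ ⟨qY.base x, hy₁⟩
    rw [← V.ι.isEmbedding.isInducing.specializes_iff]
    exact specializes_of_eq hpt.symm
  -- the affine model `Spec (S ⊗_{R[T]} R)`, `S = 𝒪_{X₁,x}`, `R = 𝒪_{Y,y₁}`
  let S : CommRingCat.{u} := X₁.presheaf.stalk x
  let R : CommRingCat.{u} := Y.presheaf.stalk (qY.base x)
  let t : n → S := fun i =>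
    (Scheme.ΓSpecIso S).hom ((X₁.fromSpecStalk x ≫ q).appTop (AffineSpace.coord Y i))
  let a' : n → R := fun i => (Scheme.ΓSpecIso R).hom (iV.appTop (a i))
  letI algS : Algebra (MvPolynomial n R) S :=
    (MvPolynomial.eval₂Hom (qY.stalkMap x).hom t).toAlgebra
  letI algR : Algebra (MvPolynomial n R) R := (MvPolynomial.eval a').toAlgebra
  have hsurjR : Function.Surjective (algebraMap (MvPolynomial n R) R) := fun c =>
    ⟨MvPolynomial.C c, MvPolynomial.eval_C c⟩
  have hsq := sliceRegular_isPullback_affineModel (n := n) (iV ≫ V.ι) (X₁.fromSpecStalk x ≫ q)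
    (iV ≫ σ) (by
      rw [Category.assoc, ← hqY, ← E1]
      congr 2
      apply CommRingCat.hom_ext
      exact (MvPolynomial.eval₂Hom_comp_C _ _).symm) (by rw [Category.assoc, hσ])
    (MvPolynomial.eval₂Hom_comp_C _ _) (fun i => MvPolynomial.eval₂Hom_X' _ _ i) (fun i => by
      rw [Scheme.Hom.comp_appTop, CommRingCat.comp_apply, hσa]
      exact MvPolynomial.eval_X _)
  -- the chart `Φ : Spec (S ⊗ R) → X₁ ×_{𝔸ⁿ_Y} V`, a flat preimmersion with `z` in its image
  have hmapF := MorphismProperty.pullbackMap (P := @Flat) (f' := q) (g' := σ)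
    (i₁ := X₁.fromSpecStalk x) (i₂ := iV) ‹_› ‹_› rfl rfl
  have hmapP := MorphismProperty.pullbackMap (P := @IsPreimmersion) (f' := q) (g' := σ)
    (i₁ := X₁.fromSpecStalk x) (i₂ := iV) inferInstance ‹_› rfl rfl
  obtain ⟨Φ, hΦ⟩ : ∃ Φ : Spec (CommRingCat.of (S ⊗[MvPolynomial n R] R)) ⟶ pullback q σ,
      Φ = hsq.isoPullback.hom ≫ pullback.map (X₁.fromSpecStalk x ≫ q) (iV ≫ σ) q σ
        (X₁.fromSpecStalk x) iV (𝟙 _) ((Category.comp_id _).trans rfl)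
        ((Category.comp_id _).trans rfl) := ⟨_, rfl⟩
  obtain ⟨_, _⟩ : Flat Φ ∧ IsPreimmersion Φ := by
    haveI := hmapF; haveI := hmapP; rw [hΦ]; exact ⟨inferInstance, inferInstance⟩
  have hΦfst : Φ ≫ pullback.fst q σ =
      Spec.map (CommRingCat.ofHom (Algebra.TensorProduct.includeLeftRingHom :
        S →+* S ⊗[MvPolynomial n R] R)) ≫ X₁.fromSpecStalk x := by
    rw [hΦ, Category.assoc, pullback.lift_fst, ← Category.assoc, hsq.isoPullback_hom_fst]
  obtain ⟨w, hw⟩ : z ∈ Set.range Φ.base := by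
    rw [hΦ, Scheme.Hom.comp_base, TopCat.coe_comp, Set.range_comp,
      (hsq.isoPullback.hom).surjective.range_eq, Set.image_univ, Scheme.Pullback.range_map]
    exact ⟨hzx, hzv⟩
  haveI := isIso_stalkMap_of_flat_of_isPreimmersion Φ w
  -- `w` lies over the closed point of `Spec S`, so it is the closed point of `Spec (S ⊗ R)`
  have hwS : (Spec.map (CommRingCat.ofHom (Algebra.TensorProduct.includeLeftRingHom :
      S →+* S ⊗[MvPolynomial n R] R))).base w = IsLocalRing.closedPoint S := by
    apply (X₁.fromSpecStalk x).isEmbedding.injective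
    rw [← Scheme.Hom.comp_apply, ← hΦfst, Scheme.Hom.comp_apply, hw, hx,
      Scheme.fromSpecStalk_closedPoint]
  have hsurjT : Function.Surjective (Algebra.TensorProduct.includeLeftRingHom :
      S →+* S ⊗[MvPolynomial n R] R) :=
    Algebra.TensorProduct.includeLeft_surjective (R := MvPolynomial n R) (S := S) (A := S) hsurjR
  obtain ⟨hlocT, hmax⟩ := sliceRegular_eq_maximalIdeal _ hsurjT w.asIdeal
    (congrArg PrimeSpectrum.asIdeal hwS)
  have hwc : w = IsLocalRing.closedPoint (S ⊗[MvPolynomial n R] R) := PrimeSpectrum.ext hmax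
  -- the ring `S ⊗ R = S / (tᵢ - aᵢ)`
  let ε : (S ⊗[MvPolynomial n R] R) ≃ₐ[S]
      S ⧸ (RingHom.ker (algebraMap (MvPolynomial n R) R)).map (algebraMap (MvPolynomial n R) S) :=
    (Algebra.TensorProduct.congr (AlgEquiv.refl : S ≃ₐ[S] S)
      (Ideal.quotientKerAlgEquivOfSurjective (f := Algebra.ofId (MvPolynomial n R) R)
        hsurjR).symm).trans (Algebra.TensorProduct.quotIdealMapEquivTensorQuot S _).symm
  have key : ∀ sec : Γ(X₁, ⊤), (Scheme.ΓSpecIso (X₁.presheaf.stalk x)).hom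
      ((X₁.fromSpecStalk x).appTop sec) = X₁.presheaf.germ ⊤ x trivial sec := by
    intro sec
    obtain ⟨s, rfl⟩ : ∃ s, (Scheme.ΓSpecIso Γ(X₁, ⊤)).hom s = sec :=
      ⟨(Scheme.ΓSpecIso Γ(X₁, ⊤)).inv sec, by simp⟩
    have h1 : (X₁.fromSpecStalk x).appTop (X₁.toSpecΓ.appTop s) =
        (Spec.map (X₁.presheaf.germ ⊤ x trivial)).appTop s := by
      rw [← CommRingCat.comp_apply, ← Scheme.Hom.comp_appTop, Scheme.fromSpecStalk_toSpecΓ]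
    rw [← Scheme.toSpecΓ_appTop, h1]
    conv_lhs => rw [← CommRingCat.comp_apply, Scheme.ΓSpecIso_naturality, CommRingCat.comp_apply]
    rw [Scheme.toSpecΓ_appTop]
  have hJ : (RingHom.ker (algebraMap (MvPolynomial n R) R)).map (algebraMap (MvPolynomial n R) S) =
      Ideal.span (Set.range fun i => X₁.presheaf.germ ⊤ x trivial
        (q.appTop (AffineSpace.coord Y i)) -
          ((qY.stalkMap x).hom.comp ((Scheme.ΓSpecIso R).hom.hom.comp iV.appTop.hom)) (a i)) := by
    change (RingHom.ker (MvPolynomial.eval a')).map _ = _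
    rw [sliceRegular_ker_eval, Ideal.map_span, ← Set.range_comp]
    refine congrArg Ideal.span (congrArg Set.range (funext fun i => ?_))
    simp only [Function.comp_apply, map_sub, RingHom.algebraMap_toAlgebra,
      MvPolynomial.eval₂Hom_X', MvPolynomial.eval₂Hom_C, RingHom.comp_apply]
    change (Scheme.ΓSpecIso (X₁.presheaf.stalk x)).hom
      ((X₁.fromSpecStalk x ≫ q).appTop (AffineSpace.coord Y i)) - _ = _
    rw [Scheme.Hom.comp_appTop, CommRingCat.comp_apply, key]
  -- assembling the isomorphism `𝒪_{X_σ,z} ≅ 𝒪_{Spec (S ⊗ R), w} ≅ S ⊗ R ≅ S/(tᵢ - aᵢ)`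
  refine ⟨(qY.stalkMap x).hom.comp ((Scheme.ΓSpecIso R).hom.hom.comp iV.appTop.hom), ⟨?_⟩⟩
  haveI : IsLocalRing (CommRingCat.of (S ⊗[MvPolynomial n R] R)) := hlocT
  exact ((pullback q σ).presheaf.stalkCongr (.of_eq hw.symm) ≪≫ asIso (Φ.stalkMap w) ≪≫
      (Spec (CommRingCat.of (S ⊗[MvPolynomial n R] R))).presheaf.stalkCongr (.of_eq hwc) ≪≫
        stalkClosedPointIso (CommRingCat.of (S ⊗[MvPolynomial n R] R))
          ).commRingCatIsoToRingEquiv.trans (ε.toRingEquiv.trans (Ideal.quotEquivOfEq hJ))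

/-! ## Formal smoothness over the polynomial ring at a point of the smooth locus -/

/-- **Formal smoothness over `K[T]` at a point of the smooth locus.** For `h : X₁ → 𝔸ⁿ_{Spec K}`
whose stalk map `𝒪_{𝔸ⁿ,h(x)} → 𝒪_{X₁,x}` is formally smooth, the ring map `K[T] → 𝒪_{X₁,x}`,
`Tᵢ ↦` germ of `h*(Tᵢ)`, obtained through the localization `K[T] = Γ(𝔸ⁿ_K) → 𝒪_{𝔸ⁿ,h(x)}`, is
formally smooth (localizations are formally smooth and formal smoothness composes). [folklore] -/
theorem sliceRegular_formallySmooth_polynomial {n : Type u} {K : CommRingCat.{u}} {X₁ : Scheme.{u}}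
    (h : X₁ ⟶ 𝔸(n; Spec K)) (x : X₁) (hx : (h.stalkMap x).hom.FormallySmooth) :
    ∃ ψ : MvPolynomial n K →+* X₁.presheaf.stalk x, ψ.FormallySmooth ∧
      ∀ i, ψ (MvPolynomial.X i) =
        X₁.presheaf.germ ⊤ x trivial (h.appTop (AffineSpace.coord (Spec K) i)) := by
  let e := AffineSpace.SpecIso n K
  let pt : Spec (CommRingCat.of (MvPolynomial n K)) := e.hom.base (h.base x)
  -- `K[T] → 𝒪_{Spec K[T], pt}` is a localization, hence formally smooth
  let θ₀ := StructureSheaf.toStalk (MvPolynomial n K) pt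
  have h₀ : θ₀.hom.FormallySmooth :=
    RingHom.formallySmooth_algebraMap.mpr
      (Algebra.FormallySmooth.of_isLocalization
        (Rₘ := (Spec.structureSheaf (MvPolynomial n K)).presheaf.stalk pt) pt.asIdeal.primeCompl)
  -- `𝒪_{Spec K[T], pt} ≅ 𝒪_{𝔸ⁿ_K, h x}` along `𝔸ⁿ_{Spec K} ≅ Spec K[T]`
  let θ₁ := e.hom.stalkMap (h.base x)
  have h₁ : θ₁.hom.FormallySmooth :=
    RingHom.FormallySmooth.of_bijective (ConcreteCategory.bijective_of_isIso θ₁)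
  refine ⟨(h.stalkMap x).hom.comp (θ₁.hom.comp θ₀.hom), (h₀.comp h₁).comp hx, fun i => ?_⟩
  have hcoord : e.hom.appTop ((Scheme.ΓSpecIso (CommRingCat.of (MvPolynomial n K))).inv
      (MvPolynomial.X i)) = AffineSpace.coord (Spec K) i := by
    rw [← AffineSpace.SpecIso_inv_appTop_coord, ← CommRingCat.comp_apply,
      ← Scheme.Hom.comp_appTop, Iso.hom_inv_id, Scheme.Hom.id_appTop, CommRingCat.id_apply]
  change (h.stalkMap x) ((e.hom.stalkMap (h.base x))
    ((Spec (CommRingCat.of (MvPolynomial n K))).presheaf.germ ⊤ (e.hom.base (h.base x)) trivial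
      ((Scheme.ΓSpecIso (CommRingCat.of (MvPolynomial n K))).inv (MvPolynomial.X i)))) = _
  rw [Scheme.Hom.germ_stalkMap_apply]
  change (h.stalkMap x) (𝔸(n; Spec K).presheaf.germ ⊤ (h.base x) trivial
    (e.hom.appTop ((Scheme.ΓSpecIso (CommRingCat.of (MvPolynomial n K))).inv
      (MvPolynomial.X i)))) = _
  rw [Scheme.Hom.germ_stalkMap_apply, hcoord]
  rfl

/-- **STUB `stub_sliceRegular` — the sliced scheme is regular near the fibre.** With
`σ = (gᵢᵖ)ᵢ : V → 𝔸ˢ_Y` and `X_σ := X₁ ×_{𝔸ˢ_Y} V`: if `X₁` is regular, `π` proper and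
`h : X₁ → 𝔸ˢ_{𝔽_p}` smooth at every point over `b = σ(y)`, then over the open
`O := V₁ ∖ π(non-smooth locus of h) ∋ b` of `𝔸ˢ_Y` every local ring of `X_σ` is regular: at
`z ∈ X_σ` over `x ∈ X₁` with `h` smooth at `x`, `𝒪_{X_σ,z} ≅ 𝒪_{X₁,x}/(tᵢ - gᵢᵖ)ᵢ`
(`sliceRegular_stalk_equiv`) is regular by the `p`-th power slicing lemma
`stub_pthPowerSliceAlgebra` (`𝒪_{X₁,x}` is regular and formally smooth over `𝔽_p[T]`,
`d(gᵖ) = 0`). [cite: EGAIV4, 17.11.1] -/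
theorem stub_sliceRegular :
    ∀ p : ℕ, p.Prime → ∀ (Y : Scheme.{0}) (f : Y ⟶ Spec (.of (ZMod p))) (s : ℕ)
      (V₁ : (AffineSpace (Fin s) Y).Opens) (X₁ : Scheme.{0}) (π : X₁ ⟶ (V₁ : Scheme.{0}))
      [IsProper π] [LocallyOfFinitePresentation (π ≫ V₁.ι ≫ AffineSpace.map (Fin s) f)],
      Scheme.IsRegular X₁ →
      ∀ (V : Y.Opens) (y : Y) (hyV : y ∈ V) (g : Fin s → Γ((V : Scheme.{0}), ⊤)),
      (AffineSpace.homOfVector V.ι (fun i => g i ^ p)).base ⟨y, hyV⟩ ∈ V₁ →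
      (∀ x : X₁, (π ≫ V₁.ι).base x = (AffineSpace.homOfVector V.ι (fun i => g i ^ p)).base ⟨y, hyV⟩ →
          x ∈ (π ≫ V₁.ι ≫ AffineSpace.map (Fin s) f).smoothLocus) →
      ∃ O : (AffineSpace (Fin s) Y).Opens,
        (AffineSpace.homOfVector V.ι (fun i => g i ^ p)).base ⟨y, hyV⟩ ∈ O ∧
        ∀ z : ↥(pullback (π ≫ V₁.ι) (AffineSpace.homOfVector V.ι (fun i => g i ^ p))),
          (pullback.fst (π ≫ V₁.ι) (AffineSpace.homOfVector V.ι (fun i => g i ^ p)) ≫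
              π ≫ V₁.ι).base z ∈ O →
          IsRegularLocalRing ((pullback (π ≫ V₁.ι)
            (AffineSpace.homOfVector V.ι (fun i => g i ^ p))).presheaf.stalk z) := by
  intro p hp Y f s V₁ X₁ π _ _ hreg V y hyV g hb hsm
  -- the open `O := V₁ ∖ π(N)`, `N` the (closed) non-smooth locus of `h = π ≫ V₁.ι ≫ 𝔸ˢ(f)`
  have hπN : IsClosed (π.base '' ((π ≫ V₁.ι ≫ AffineSpace.map (Fin s) f).smoothLocus : Set X₁)ᶜ) :=
    π.isClosedMap _ (π ≫ V₁.ι ≫ AffineSpace.map (Fin s) f).smoothLocus.2.isClosed_compl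
  refine ⟨V₁.ι ''ᵁ ⟨(π.base '' ((π ≫ V₁.ι ≫ AffineSpace.map (Fin s) f).smoothLocus : Set X₁)ᶜ)ᶜ,
    hπN.isOpen_compl⟩, ?_, fun z hz => ?_⟩
  · -- `b ∈ O`: the fibre of `π` over `b` lies in the smooth locus
    change ((⟨_, hb⟩ : V₁) : ↥(AffineSpace (Fin s) Y)) ∈ V₁.ι ''ᵁ _
    rw [Scheme.Opens.mem_ι_image_iff]
    rintro ⟨x, hxN, hπx⟩
    refine hxN (hsm x ?_)
    rw [Scheme.Hom.comp_apply, hπx]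
    rfl
  -- `x := fst z` lies in the smooth locus of `h`
  have hxsm : (pullback.fst (π ≫ V₁.ι) (AffineSpace.homOfVector V.ι fun i => g i ^ p)).base z ∈
      (π ≫ V₁.ι ≫ AffineSpace.map (Fin s) f).smoothLocus := by
    rw [Scheme.Hom.comp_apply, Scheme.Hom.comp_apply] at hz
    have hz' : (π.base ((pullback.fst (π ≫ V₁.ι)
        (AffineSpace.homOfVector V.ι fun i => g i ^ p)).base z)).1 ∈ V₁.ι ''ᵁ _ := hz
    rw [Scheme.Opens.mem_ι_image_iff] at hz'
    by_contra hxN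
    exact hz' ⟨_, hxN, rfl⟩
  -- the local ring `𝒪_{X_σ,z} ≅ 𝒪_{X₁,x}/(tᵢ - gᵢᵖ)ᵢ`
  obtain ⟨β, ⟨ε⟩⟩ := sliceRegular_stalk_equiv (π ≫ V₁.ι) V
    (AffineSpace.homOfVector V.ι fun i => g i ^ p) (fun i => g i ^ p)
    (AffineSpace.homOfVector_over _ _) (AffineSpace.homOfVector_appTop_coord _ _) z
  -- `𝒪_{X₁,x}` is regular, and formally smooth over `𝔽_p[T]`
  obtain ⟨ψ, hψ, hψX⟩ := sliceRegular_formallySmooth_polynomial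
    (π ≫ V₁.ι ≫ AffineSpace.map (Fin s) f) _ hxsm
  generalize (pullback.fst (π ≫ V₁.ι) (AffineSpace.homOfVector V.ι fun i => g i ^ p)).base z = x
    at β ε ψ hψ hψX
  letI := ψ.toAlgebra
  haveI : Algebra.FormallySmooth (MvPolynomial (Fin s) (ZMod p)) (X₁.presheaf.stalk x) := hψ
  haveI := hreg x
  have hJ : Ideal.span (Set.range fun i => X₁.presheaf.germ ⊤ x trivial
        ((π ≫ V₁.ι).appTop (AffineSpace.coord Y i)) - β (g i ^ p)) =
      Ideal.span (Set.range fun i => algebraMap (MvPolynomial (Fin s) (ZMod p))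
        (X₁.presheaf.stalk x) (MvPolynomial.X i) - β (g i) ^ p) := by
    refine congrArg Ideal.span (congrArg Set.range (funext fun i => ?_))
    rw [map_pow, RingHom.algebraMap_toAlgebra, hψX]
    simp only [Scheme.Hom.comp_appTop, CommRingCat.comp_apply, AffineSpace.map_appTop_coord]
  -- the ideal `(tᵢ - gᵢᵖ)` is proper (the local ring of `X_σ` at `z` is not zero)
  have hne : Ideal.span (Set.range fun i => algebraMap (MvPolynomial (Fin s) (ZMod p))
      (X₁.presheaf.stalk x) (MvPolynomial.X i) - β (g i) ^ p) ≠ ⊤ := by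
    intro htop
    haveI := Ideal.Quotient.subsingleton_iff.mpr htop
    exact not_subsingleton _ (ε.trans (Ideal.quotEquivOfEq hJ)).toEquiv.subsingleton
  -- the `p`-th power slicing lemma
  have halg := stub_pthPowerSliceAlgebra p hp s (X₁.presheaf.stalk x) (fun i => β (g i))
    fun i => IsLocalRing.le_maximalIdeal hne (Ideal.subset_span ⟨i, rfl⟩)
  exact IsRegularLocalRing.of_ringEquiv (ε.trans (Ideal.quotEquivOfEq hJ)).symm

end Summit.ResolutionOfSingularities.ResolutionOfSingularities.Theorems.ProductDescent.Birth

end
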